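import Mathlib
import HarnessLib
import HarnessLib.Audit
import Summits.AtomisticToContinuum.Statement
import Literature.Geometry.DiscreteGeometry.KissingPatterns
import Literature.MathematicalPhysics.StatisticalMechanics.BarlowStacking
import Literature.MathematicalPhysics.StatisticalMechanics.LennardJonesClusters
import Literature.MathematicalPhysics.StatisticalMechanics.LennardJonesThermodynamicLimit

/-!
Route: CrystalSplittingCertificates

CLOSED (retired) 2026-08-15T13:41:29Z by operator:999:1257524 — reason: not-a-thesis: assembly does not conclude the sub-problem Statement — note: D-0027 §2.1 audit (human 2026-08-15: routes that do not decide the summit are removed): the assembly concludes `Literature.MathematicalPhysics.StatisticalMechanics.Crystallization`, not the sub-problem statement; a NEW conforming route may be opened from the same idea (generated `closes : … → _root_. The file is kept as the record of this route; refuted decls are indexed as negative knowledge (`ledger negatives`).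

# Route CrystalSplittingCertificates — Certificates are free, the crystal is their continuity —
finite-range pair-splitting certificates for Lennard-Jones and the rigidity of their tight set

Realises card free-pair-splitting-certificates ("certificates exist for free; the crystal is their
continuity") in finite-N form. A PAIR-SPLITTING RULE of radius R is a function Φ giving the bond
(i,j) of any finite configuration x the weight w_ij = Φ(x_j − x_i, pattern of x in B(x_i,R) ∪
B(x_j,R) recentred at x_i) ∈ [0,1] with w_ij + w_ji = 1 (every bond's Lennard-Jones energy is merely
SPLIT between its two ends; no other transfers, no cells, no scores); the weighted site energy is
Σ_j w_ij V_LJ(r_ij) and the threshold is Fekete's constant e_∞ = inf_M E(M)/M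
(BlancLewin2015_8_holds, proved in tree).
It suffices to show X = X₁ ∧ X₂:
X₁ (StrictSplittingRule): there are R, a scale a, a twelve-point shell S within a/100 of the
a-scaled HCP kissing pattern, and a rule Φ that is FEASIBLE — every site of every finite injective
configuration in ℝ³ has weighted energy ≥ e_∞ — and STRICT — for every η > 0 some c > 0 makes
"weighted energy < e_∞ + c" force the first shell (radius 5a/4) to be η-close, up to O(3), to S.
X₂ (ShellRigidityHcp, rule-free geometry): configurations all of whose first shells inside an L-ball
are η-close to S carry, on the R'-ball, an ε'-matched window of ONE periodic configuration P (the
hcp crystal of S).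
The unrestricted-range certificate exists unconditionally (FreePairSplitting = Fekete + Gale–Hoffman
supply–demand duality), so X₁ is purely a LOCALITY statement: the card's "sub-action regularity"
crux R3 made finite.
Lean: `(∃ (R : ℝ) (Φ : EuclideanSpace ℝ (Fin 3) → Finset (EuclideanSpace ℝ (Fin 3)) → ℝ) (a : ℝ) (S
: Finset (EuclideanSpace ℝ (Fin 3))), 0 < R ∧ 0 < a ∧ ((∀ v T, 0 ≤ Φ v T ∧ Φ v T ≤ 1) ∧ (∀ v T, v ≠
0 → Φ v T + Φ (-v) (T.image fun u => u - v) = 1)) ∧ (∀ (N : ℕ) (x : Fin N → EuclideanSpace ℝ (Fin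
3)), Function.Injective x → ∀ i : Fin N, (⨅ M : ℕ,
Literature.MathematicalPhysics.StatisticalMechanics.groundStateEnergy
Literature.MathematicalPhysics.StatisticalMechanics.lennardJones 3 (M + 1) / ((M + 1 : ℕ) : ℝ)) ≤ ∑
j ∈ Finset.univ.erase i, Φ (x j - x i) ((Finset.univ.filter fun k => dist (x k) (x i) ≤ R ∨ dist (x
k) (x j) ≤ R).image fun k => x k - x i) *
Literature.MathematicalPhysics.StatisticalMechanics.lennardJones (dist (x i) (x j))) ∧
Literature.Geometry.DiscreteGeometry.ShellCloseTo (a / 100) S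
(Literature.Geometry.DiscreteGeometry.hcpKissingPattern.image fun u => a • u) ∧ ∀ η : ℝ, 0 < η → ∃ c
: ℝ, 0 < c ∧ ∀ (N : ℕ) (x : Fin N → EuclideanSpace ℝ (Fin 3)), Function.Injective x → ∀ k : Fin N, ∑
j ∈ Finset.univ.erase k, Φ (x j - x k) ((Finset.univ.filter fun l => dist (x l) (x k) ≤ R ∨ dist (x
l) (x j) ≤ R).image fun l => x l - x k) *
Literature.MathematicalPhysics.StatisticalMechanics.lennardJones (dist (x k) (x j)) < (⨅ M : ℕ,
Literature.MathematicalPhysics.StatisticalMechanics.groundStateEnergy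
Literature.MathematicalPhysics.StatisticalMechanics.lennardJones 3 (M + 1) / ((M + 1 : ℕ) : ℝ)) + c
→ Literature.Geometry.DiscreteGeometry.ShellCloseTo η ((Finset.univ.filter fun j => j ≠ k ∧ dist (x
j) (x k) ≤ 5 * a / 4).image fun j => x j - x k) S) ∧ (∀ a : ℝ, 0 < a → ∀ S : Finset (EuclideanSpace
ℝ (Fin 3)), Literature.Geometry.DiscreteGeometry.ShellCloseTo (a / 100) S
(Literature.Geometry.DiscreteGeometry.hcpKissingPattern.image fun u => a • u) → ∃ P :
Literature.MathematicalPhysics.StatisticalMechanics.PeriodicConfiguration 3, ∀ δ R' ε' : ℝ, 0 < δ →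
0 < R' → 0 < ε' → ∃ η : ℝ, 0 < η ∧ ∃ L : ℝ, ∀ (N : ℕ) (x : Fin N → EuclideanSpace ℝ (Fin 3)), (∀ i
j, i ≠ j → δ ≤ dist (x i) (x j)) → ∀ i : Fin N, (∀ k : Fin N, dist (x k) (x i) ≤ L →
Literature.Geometry.DiscreteGeometry.ShellCloseTo η ((Finset.univ.filter fun j => j ≠ k ∧ dist (x j)
(x k) ≤ 5 * a / 4).image fun j => x j - x k) S) → ∃ q ∈ P.points, ∃ A : EuclideanSpace ℝ (Fin 3)
→ₗᵢ[ℝ] EuclideanSpace ℝ (Fin 3), (∀ p ∈ P.points, dist p q ≤ R' → ∃ j : Fin N, dist (x j) (x i + A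
(p - q)) ≤ ε') ∧ (∀ j : Fin N, dist (x j) (x i) ≤ R' → ∃ p ∈ P.points, dist (x j) (x i + A (p - q))
≤ ε'))`

## Assembly
StrictSplittingRule and ShellRigidityHcp give, through DefectVanishOfStrict, one periodic P whose
windows are carried by all but o(N) ground-state sites (the only analytic inputs are proved tree
facts: BlancLewin2015_8_holds for Σ slack = E(N) − N·e_∞ = o(N), LennardJonesMinimalDistance_holds
for bounded density, LennardJonesGroundStatesExist_holds); DefectVanishCrystallizes turns this into
IsCrystallizing lennardJones 3 and DefectVanishEnergy (with PeriodicUpperBound) into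
HasPeriodicGroundStateEnergy lennardJones 3; their conjunction is
Literature.MathematicalPhysics.StatisticalMechanics.Crystallization by definition. Given the four
support items the assembly is pure logic (checked in Sketch.lean). FiniteRangeSplitting and
ApproxFiniteRangeSplitting are the lower rungs of the same ladder (Ladder) — staffed because their
refutation is the cheapest kill and their proof is the construction path to StrictSplittingRule —
and are not hypotheses of the assembly.

Rationale: WHY THIS LINE. Mechanism (card free-pair-splitting-certificates): by Fekete E(A) ≥ |A|·e_∞ for every
finite sub-configuration A, which is exactly the cut condition of Gale's/Hoffman's supply–demand
theorem for splitting each bond's energy between its ends — so a certificate "every site carries ≥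
e_∞" exists for EVERY configuration with no computation (FreePairSplitting), and the only thing a
Flyspeck/Theil-type local inequality really asserts is that the splitting can be chosen by a
BOUNDED-RADIUS RULE (FiniteRangeSplitting) and strictly (StrictSplittingRule). Imports:
network-flow/LP duality (Gale–Hoffman) for existence; m-potential / ergodic-optimisation theory
(HolsztynskiSlawny1978, Miekisz1998, GaribaldiThieullen2014) as the frame that names the crux
"regularity of a coboundary" and warns it can fail (ultimate frustration); discrete geometry of
layer propagation (HalesDSP2012 §1.3, proved in tree as HalesDSP_layerPackings_holds) for X₂. What
it does that the existing routes do not: CrystalLocalRigidity (a) asks for an unspecified localised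
energy e_loc ≥ ⨅_periodic with equality iff Barlow — here the certificate class is canonical and
minimal (bond splittings, capacity |V|), its unrestricted existence is a theorem, and the threshold
is e_∞ itself, so total slack on ground states is E(N) − N·e_∞ = o(N) FOR FREE (no surface term, no
periodic-infimum bookkeeping, no N^{2/3} estimate); CrystalKissingRigidity goes energy → soft
12-coordination → robust Fejes Tóth (fcc-or-hcp, then stacking selection by J_k) — here the
certified quantity is the FULL site energy, so the tight set sees the r⁻⁶ tail and the certificate
itself selects the polytype through S (only the h-only, anticuboctahedral rigidity is needed, whose
exact case is already proved). Negatives index: empty at filing.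

RANKED CRUXES. #2 FiniteRangeSplitting (crux) — (card R3, "finite frustration range") there are R >
0 and a pair-splitting rule Φ of radius R (box 0 ≤ Φ ≤ 1; complementarity Φ(v,T) + Φ(−v, T − v) = 1;
the weight of bond (i,j) is Φ(x_j − x_i, {x_k − x_i : dist(x_k,x_i) ≤ R ∨ dist(x_k,x_j) ≤ R})) such
that for every N, every injective x : Fin N → ℝ³ and every site i: Σ_{j≠i} w_ij V_LJ(|x_i − x_j|) ≥
e_∞ := ⨅_M E(M+1)/(M+1). Far bonds are NOT frozen at ½ (a frozen far field is refuted by "hcp ball +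
distant interstitial", see CHEAPEST FALSIFIER); locality = dependence on the two endpoint patterns
only. [difficulty: open-problem] (why it might fail: False iff LJ is 'ultimately frustrated' at
bounded radius: tight bulk has zero slack, so icosahedral-core deficits and first-order far-field
imbalances (distant strained/misoriented matter) must be absorbed by endpoint patterns alone; relay
through perfect regions is impossible.) [Miekisz1998, HolsztynskiSlawny1978, GaribaldiThieullen2014,
Hales2012, arXiv:1209.6043, BlancLewin2015, arXiv:1504.01153,
Literature.Barriers.AtomisticToContinuum.TetrahedralFrustration,
Literature.Barriers.AtomisticToContinuum.IcosahedralClusters, card:frustration-range-lp-hierarchy]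
#3 StrictSplittingRule (crux) — (card R2/F4 made quantitative; X₁) there are R, Φ as in
FiniteRangeSplitting, a scale a > 0 and a twelve-point shell S with ShellCloseTo (a/100) S
(a·hcpKissingPattern) such that Φ is feasible AND for every η > 0 there is c > 0 with: for every
finite injective configuration and site k, weighted site energy < e_∞ + c ⇒ ShellCloseTo η (first
shell of k within 5a/4, recentred) S. The certificate selects the polytype: fcc-type (cuboctahedral)
sites must carry slack ≥ c(η) ≈ e_fcc − e_hcp, surface/vacancy/grain-boundary sites much more; near
the optimal crystal c(η) ~ κη² is sitewise phonon stability. [deps: FiniteRangeSplitting]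
[difficulty: open-problem] (why it might fail: Needs relaxed hcp to be the UNIQUE LJ energy-density
minimiser with a gap vs every other environment (fcc-type sites cost only ~7e-5): a tying
polytype/FK phase, or failure of sitewise quadratic (phonon) stability c(eta)~eta^2 under
bounded-range weights, kills it.) [Stillinger2001, KiharaKoba1952, SchwerdtfegerBurrowsSmits2021,
PartayOrtnerCsanyi2017, arXiv:1705.01751, FrieseckeTheil2002, EMing2006, HalesDSP2012,
Literature.Barriers.AtomisticToContinuum.ShortRangeStackingBlindness,
stmt-AtomisticToContinuum-0670]
#4 ShellRigidityHcp (crux) — (X₂, rule-free) for every a > 0 and every twelve-point S within a/100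
of a·hcpKissingPattern there is a periodic configuration P such that for all δ, R', ε' > 0 there are
η > 0 and L with: in any finite δ-separated configuration, a site i all of whose neighbours within L
have first shells (radius 5a/4) η-close to S has its R'-window two-sidedly ε'-matched to x_i +
A(P.points − q) for some q ∈ P.points and linear isometry A. Exact (η = 0, L = ∞) case =
ExactHcpShellsRigidity (support) via HalesDSP_layerPackings_holds; the crux is the
compactness/propagation upgrade with P = the (possibly non-ideal c/a) hcp crystal of S. [difficulty:
L] (why it might fail: Exact case = Hales layer argument (h-only; HalesDSP_layerPackings_holds); the
robust finite-L version can fail if a near-anticuboctahedral S admits locally-S textures (slow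
twist, two realisations, KKLS-type flexibility) not eps'-close to one P over radius R'.)
[HalesDSP2012, Hales2012, arXiv:1209.6043,
Literature.Geometry.DiscreteGeometry.HalesDSP_layerPackings_holds, KusnerKusnerLagariasShlosman2018,
arXiv:1611.10297, Literature.Barriers.AtomisticToContinuum.FlexibleKissingArrangements,
Literature.Barriers.AtomisticToContinuum.KissingTwelveDegeneracy]
#5 ApproxFiniteRangeSplitting (crux) — (lowest rung; card R1 in finite form) for every ε > 0 there
are R(ε) and a rule Φ of radius R(ε) with weighted site energy ≥ e_∞ − ε at every site of every
finite injective configuration. FiniteRangeSplitting ⇒ this (Ladder); its refutation for one ε kills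
the whole line and gives every certificate route (0620/(a), Flyspeck-type) an infinite minimal
nonlocality; in Miękisz's lattice examples exactly this rung holds while the exact one fails.
[difficulty: XL] (why it might fail: False iff some eps0>0 is lost by EVERY finite-range rule on
some site of some configuration: an N-uniform duality gap (quantitative ultimate frustration,
Miekisz-type); witness = configuration family whose deficit regions outrun any fixed radius.)
[Miekisz1998, Miekisz1993, KullEtAl2024, Lagarias2002LocalDensity, BlancLewin2015,
card:frustration-range-lp-hierarchy,
Literature.Barriers.AtomisticToContinuum.AperiodicTilingGroundStates]
#9 FreePairSplitting (support) — (the card's lemma (2): "certificates are free") for every N and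
every injective x : Fin N → ℝ³ there are weights w_ij ≥ 0, w_ij + w_ji = 1, with Σ_{j≠i} w_ij
V_LJ(r_ij) ≥ e_∞ at every site. Proof: Gale 1957 / Hoffman supply–demand theorem (max-flow/min-cut
with capacities |V(r_ij)|, demands e_∞ + Σ_{j: V<0}|V_ij|); the cut condition for A ⊆ Fin N is
Σ_{inside A} V + Σ_{cross} V⁺ ≥ |A|·e_∞, implied by E(A) ≥ E(|A|) ≥ |A|·e_∞ (BlancLewin2015_8_holds:
e_∞ = inf). Mathlib route: finite LP duality via hyperplane separation of a finitely generated cone.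
[difficulty: M] [Gale1979, Hoffman1992, BlancLewin2015, arXiv:1504.01153]
#9 SlackDensity (support) — for any rule (box + complementarity) that is feasible, and any c > 0,
along every sequence of Lennard-Jones ground states the fraction of sites with weighted energy ≥ e_∞
+ c tends to 0. Proof: complementarity gives Σ_i (weighted site energy) = interactionEnergy = E(N);
E(N) − N·e_∞ = o(N) and each slack ≥ 0 (feasibility) ⇒ Markov. Uses only BlancLewin2015_8_holds
(proved). [difficulty: provable-now] [BlancLewin2015,
Literature.MathematicalPhysics.StatisticalMechanics.BlancLewin2015_8_holds]
#9 PeriodicUpperBound (support) — e_∞ ≤ e(Q) for every periodic configuration Q of ℝ³ (trial blocks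
of Q as N-point configurations; cross terms with the exterior bounded by the attractive tail,
O(N^{2/3}); summability from PeriodicConfigurationSums). Same content as items 0629 + 0714 of
CrystalLocalRigidity in the e_∞ = ⨅_M E(M+1)/(M+1) normal form used here. [difficulty: M]
[BlancLewin2015, arXiv:1504.01153, stmt-AtomisticToContinuum-0629, stmt-AtomisticToContinuum-0714]
#9 DefectVanishOfStrict (support) — (the glue X₁ → X₂ → hinge) StrictSplittingRule →
ShellRigidityHcp → ∃ P periodic, DefectVanish(P): for all R', ε' > 0, along every ground-state
sequence the fraction of sites whose R'-window is not ε'-matched to a window of P tends to 0. Proof: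
SlackDensity with c = c(η(R',ε')) ⇒ o(N) sites with non-η-close shells; ground states are
δ-separated (LennardJonesMinimalDistance_holds) so each bad site spoils ≤ C(L/δ)³ centres; apply
ShellRigidityHcp. [difficulty: M] [BlancLewin2015,
Literature.MathematicalPhysics.StatisticalMechanics.LennardJonesMinimalDistance_holds]
#9 DefectVanishCrystallizes (support) — for every periodic P, DefectVanish(P) → IsCrystallizing
lennardJones 3: choose R'_k ↑ ∞, ε'_k ↓ 0, indices N_k and good sites i_k, translate by −x_{i_k};
q_k ∈ P.points reduces modulo the lattice to finitely many motif points (subsequence), A_k → A in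
O(3) (compact); minimal distance of ground states (proved) and discreteness of P make the matching a
local bijection for ε' small, whence Σ_i f(x_i + τ_k) → Σ_{s ∈ A(P − y)} f(s), multiplicity 1; A(P −
y) is again a PeriodicConfiguration (CrystallizationSymmetries: translate, isometryImage).
[difficulty: L] [BlancLewin2015, arXiv:1504.01153, stmt-AtomisticToContinuum-0752,
Literature.MathematicalPhysics.StatisticalMechanics.LennardJonesMinimalDistance_holds]
#9 DefectVanishEnergy (support) — PeriodicUpperBound → for every periodic P, DefectVanish(P) →
HasPeriodicGroundStateEnergy lennardJones 3: good sites have site energies within o(1) of P's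
(continuity of V_LJ away from 0, uniform tail O(R'⁻³) from the minimal distance), bad sites are o(N)
with bounded site energy, so E(N)/N → e(P) (ground states exist for all N:
LennardJonesGroundStatesExist_holds); with e_∞ = lim E(N)/N ≤ e(Q) ∀Q this is IsLeast + Tendsto.
[difficulty: L] [BlancLewin2015, arXiv:1504.01153,
Literature.MathematicalPhysics.StatisticalMechanics.LennardJonesGroundStatesExist_holds]
#9 ExactHcpShellsRigidity (support) — (η = 0, L = ∞ case of ShellRigidityHcp) a nonempty V ⊂ ℝ³ in
which every point's punctured 5a/4-neighbourhood, recentred, is exactly congruent to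
a·hcpKissingPattern is an isometric image of hcpStacking a (a√(2/3)). Proof: all distances ≥ a,
rescale by 2/a to a unit-ball packing with HasFccOrHcpShells (all hcp) ⇒
HalesDSP_layerPackings_holds gives a Barlow stacking; anticuboctahedral shells everywhere force the
alternating Hägg sequence (LayerShellPatterns / BarlowCoordination). [difficulty: M] [HalesDSP2012,
Literature.Geometry.DiscreteGeometry.HalesDSP_layerPackings_holds]
#9 Ladder (support) — the rungs are nested: StrictSplittingRule → FiniteRangeSplitting and
FiniteRangeSplitting → ApproxFiniteRangeSplitting (same R, Φ). Pure logic; records that refuting a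
lower rung refutes the higher ones. [difficulty: provable-now] [Miekisz1998]

TWO-LAYER PLAN. Foreseen glued splits (none filed now): StrictSplittingRule ⇐ NearFieldDesign (an
explicit Φ₀ of radius ≈ 2.5a: Marchal-cell-type splitting of first/second-shell bonds, icosahedral
centres importing ≈ 0.03–0.06 from their strained shells) → FarFieldAttribution (bonds longer than R
split by "own-displacement / denser-end-takes-the-gain", cancelling first-order far-field terms
sitewise because the net force on every site of relaxed hcp vanishes) → LocalStability (c(η) ~ κη²:
sitewise quadratic coercivity of relaxed LJ-hcp under bounded-range weights, FrieseckeTheil2002 /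
EMing2006 type) → StrictSplittingRule. ShellRigidityHcp ⇐ ExactHcpShellsRigidity (filed) →
CompactnessUpgrade (contradiction sequences, local limits of δ-separated sets) → ShellRigidityHcp.
FiniteRangeSplitting, if attacked first, splits by regime: GrossDefects (non-12-coordinated sites:
slack from repulsion/missing bonds) → NearCrystal (strained Barlow: far-field attribution) → glue.

KILL CRITERIA. ApproxFiniteRangeSplitting refuted (an ε₀-gap for all radii) closes the route
outright (close --reason refuted:ApproxFiniteRangeSplitting) and is a barrier-grade fact for every
certificate route (0620/(a), RobustFejesTothHales-type transfers). FiniteRangeSplitting refuted with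
Approx standing: close this route (the thesis "the crystal is the continuity of the certificate" is
then false at the exact level, Miękisz scenario); a successor would need ε(R)-certificates plus
quantitative rigidity — a different thesis. StrictSplittingRule refuted by a periodic Q with e(Q) <
inf over the hcp family (certified lattice sums, cf. 0670): restate with S := Q's shell only if Q is
vertex-transitive with one shell class, else close. ShellRigidityHcp refuted (flexible
near-anticuboctahedral textures): restate with a two-shell S (radius √2·a·1.1).
CrysPeriodicMinAttained (0627) refuted elsewhere refutes the conjunct and moots everything.

NOT DECOMPOSED YET. The construction of Φ (near-field transfer design, far-field attribution), the
radius R (expected 2–3 shells from the icosahedral first-shell advantage ≈ 12 %), the stability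
constants c(η), the relaxed hcp parameters (a*, c/a) and the certified comparison hcp < fcc, dhcp,
4H, 6H, 9R (numerics exist: Stillinger2001, SchwerdtfegerBurrowsSmits2021; certified version is item
0670 of RefuteCrystalPeriodicMin and is NOT re-filed here), interval-arithmetic verification
machinery, and the infinite-volume rungs of the card (equivariant MEASURABLE splittings on the hull
by Markov–Kakutani; CONTINUOUS ones by Michael selection) — the latter are true-by-soft-argument but
need a hull/point-process formalism Lean lacks; they are recorded as motivation, not items. All of
these are layer-2 children once FiniteRangeSplitting or ShellRigidityHcp moves.

CHEAPEST FALSIFIER. (i) Lookup + certified lattice sums: relaxed hcp must be STRICTLY below fcc and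
the short-period polytypes for V = r⁻¹²/12 − r⁻⁶/6 (hcp below fcc by ≈1e−4 relative: Stillinger2001,
KiharaKoba1952, SchwerdtfegerBurrowsSmits2021; polytypes in BurrowsCooperSchwerdtfeger2021) — a tie
kills StrictSplittingRule as typed. (ii) kit LP, one afternoon: for R ∈ {1.5a, 2a, 2.5a} and a
configuration zoo (Mackay icosahedra 55/147/309, hcp balls with a vacancy / interstitial / stacking
fault / twist boundary, A15 and Z16 fragments), maximise the worst site margin t over weights forced
equal on bonds with identical (v, pattern) up to 1e−3: t stuck below e_∞ − 1e−3 as R grows is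
evidence for the ε₀-gap and refutes ApproxFiniteRangeSplitting, hence the line. Hand check done
while drafting (see NUMBERS): rules with far bonds frozen at w = ½ are already refuted by "hcp ball
+ one distant interstitial", which is why the filed rule class lets far-bond weights depend on both
endpoint patterns; two distant perfect chunks cannot over-attract (E₁₂ ≥ −(slack₁ + slack₂) by
Fekete), so no global obstruction of that kind exists — the open question is purely locality.

NUMBERS. Tree normalisation V(1) = −1/12. Lattice sums A₆ = 14.454, A₁₂ = 12.132 (fcc; hcp A₆ larger
by ≈1e−4): optimal nearest-neighbour distance a* = (A₁₂/A₆)^{1/6} ≈ 0.9713, e_∞ ≈ e(hcp) =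
−A₆²/(24A₁₂) ≈ −0.7176, e_fcc − e_hcp ≈ 7e−5 (tree numerics J₂ ≈ −7.3e−5 on 0670/0716). First shell
12 at a*, second 6 at √2·a* ≈ 1.374 (shell radius 5a/4 separates them with margin 0.12a).
Icosahedral centre first-shell value ≈ −0.50…−0.54 vs hcp −0.481 (card
frustration-range-lp-hierarchy): local advantage 0.03–0.06 to be imported within R. Centre slack of
an hcp ball of radius ρ: ≈ ½·ρ_dens·(4π/18)·ρ⁻³ ≈ 0.5ρ⁻³ (ρ_dens = √2/a*³ ≈ 1.54). Surface energy:
E(N) − N·e_∞ ≍ N^{2/3}; all the route uses is o(N). DEGENERATE CASE CHECKED BY HAND: centre of an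
hcp ball of radius ρ has slack ≈ 0.5ρ⁻³ (missing exterior tail); one interstitial at distance D from
it changes its weighted energy by w·V(D) ≈ −w·D⁻⁶/6; with w frozen at ½ this exceeds the slack for R
< D < 0.8ρ^{1/2} (e.g. ρ = 100, D < 8) — frozen far fields are infeasible at the exact threshold,
endpoint-dependent far weights (interstitial end takes the bond, w → 0) are not obstructed.

DEFINITION REQUESTS. None at open: the rule vocabulary (pattern, weighted site energy, e_∞ = ⨅_M
E(M+1)/(M+1), window matching) is inlined in every item so that all signatures elaborate now
(Sketch.lean rc 0, inlined ↔ helper versions by Iff.rfl). If the route survives grounding, request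
`SplittingRule` (structure bundling R, Φ, box, complementarity, with `weight`/`siteEnergy` API)
under Summits/AtomisticToContinuum/Crystallization/Theorems to de-duplicate. Bib:
GaribaldiThieullen2014 added (doi:10.1007/s10955-014-1139-z).

Novelty: Searches (2026-08-15): lit frontier AtomisticToContinuum --since 2020 (30 rows, none on
certificates/crystallization); lit bridges AtomisticToContinuum --cross any (30 rows, none
relevant); crossref "ergodic description of ground states" (→ doi:10.1007/s10955-014-1139-z),
"ultimate frustration lattice-gas" (→ doi:10.1023/a:1023264004272), "invariant transports stationary
random measures balancing" (→ doi:10.1214/08-aop420, doi:10.1214/16-ejp4237), "Peierls condition and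
number of ground states" (→ doi:10.1007/bf01609493), "minimum inter-particle distance Lennard-Jones
clusters lower bound energy" (→ doi:10.1023/a:1008284629099,
doi:10.1023/b:coap.0000039486.97389.87); zbMATH "Garibaldi Thieullen ground states" (4 hits incl.
arXiv:2308.13058 discrete weak KAM on quasi-periodic sets, arXiv:1512.08071); lit galaxy search
"calibrated sub-action" --star pdf (5 hits: Garibaldi–Petite–Thieullen calibrated configurations for
Frenkel–Kontorova in almost-periodic environments; Contreras periodic-orbit maximisers;
arXiv:2105.00078); lit vsearch of the pair-splitting statement (no relevant hit); the card's own
audit (refuter-3: crossref/zbMATH "max-flow min-cut energy redistribution certificate packing",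
"measurable Hall allocation ground state": nothing). OpenAlex/arXiv APIs rate-limited today; local
FTS daemon reset connections (recorded in NOTES.md).
Nearest prior art found: HolsztynskiSlawny1978 (doi:10.1007/bf01609493; m-potentials = range-R
certificates on lattices) and Miekisz1998  [refs: 10.1007/s10955-014-1139-z, 10.1023/a:1023264004272, 10.1214/08-aop420, 10.1214/16-ejp4237, 10.1007/bf01609493, 10.1023/a:1008284629099, 10.1023/b:coap.0000039486.97389.87, 2308.13058, 1512.08071, 2105.00078, 1209.6043, doi:10.1007/s10955-014-1139-z, doi:10.1023/a, doi:10.1214/08-aop420, doi:10.1214/16-ejp4237, doi:10.1007/bf01609493, doi:10.1023/b, HolsztynskiSlawny1978, Miekisz1998, Hales2012, Ha]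

Barriers (technique_class: maxflow-mincut-certificates; local-rule transfer; rigidity): - technique_class: maxflow-mincut-certificates; local-rule transfer; rigidity
- Literature.Barriers.AtomisticToContinuum.TetrahedralFrustration: applies to RAW single-cell bounds
only (audited scope); a splitting rule is a hybrid, reapportioning certificate (Lagarias's
admissible-score class, which contains the successful Hales–Ferguson/Marchal inequalities); the
barrier is re-read as "the near-field part of Φ must move ≈0.03–0.06 per icosahedral centre", which
fixes R ≳ 2 shells — the bet, not a contradiction.
- Literature.Barriers.AtomisticToContinuum.IcosahedralClusters: finite-N icosahedral ground states
are consistent with the line (their centres are deficit sites fed by strained shells; boundary sites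
have large slack); used as calibration data for c(η) and R, and as the first entries of the
falsifier zoo.
- Literature.Barriers.AtomisticToContinuum.Li2022_cohnElkies3D: a duality gap of the PAIR-MARGINAL
(Fourier) relaxation; our certificates are configuration-wise and pattern-dependent, not
translation-invariant pair functionals — not met; it does warn that low rungs of any hierarchy can
stall, which is exactly what ApproxFiniteRangeSplitting tests.
- Literature.Barriers.AtomisticToContinuum.ShortRangeStackingBlindness: evaded by construction — the
certified quantity is the full site energy Σ_j w_ij V(r_ij) over ALL j, so an fcc-type site inside
any Barlow stacking carries the tail difference (≈7e−5) as compulsory slack; the rule's RADIUS is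
finite, the certified functi

History (route lifecycle, newest last):
- 2026-08-15T13:41:30Z · CLOSED retired — not-a-thesis: assembly does not conclude the sub-problem Statement (operator:999:1257524)

sub-problem: Crystallization · status: closed(retired) · opened planner-plancard-AtomisticToContinuum-Crystal-0e276871-0 2026-08-15T11:27:02Z · rev 0 · ledger route-AtomisticToContinuum-CrystalSplittingCertificates
GENERATED by the gate from the ledger (D-0016/17). Provers cite these decls: `theorem foo : Summit.AtomisticToContinuum.Crystallization.Theses.CrystalSplittingCertificates.<Decl> := …` in Summits/AtomisticToContinuum/Crystallization/Theorems/<Name>.lean.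
-/

namespace Summit.AtomisticToContinuum.Crystallization.Theses.CrystalSplittingCertificates

open scoped BigOperators Topology Manifold Classical MeasureTheory ProbabilityTheory Matrix InnerProductSpace ComplexConjugate ContinuousMap
open Filter Set Function TopologicalSpace MeasureTheory

attribute [summit_statement] _root_.Crystallization

/-- item stmt-AtomisticToContinuum-4010 · crux · rank 2 · closed · moot by None · by planner
why it might fail: False iff LJ is 'ultimately frustrated' at bounded radius: tight bulk has zero slack, so icosahedral-core deficits and first-order far-field imbalances (distant strained/misoriented matter) must be absorbed by endpoint patterns alone; relay through perfect regions is impossible.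
sources: Miekisz1998, HolsztynskiSlawny1978, GaribaldiThieullen2014, Hales2012, arXiv:1209.6043, BlancLewin2015
[crux] (card R3, "finite frustration range") there are R > 0 and a pair-splitting rule Φ of radius R
(box 0 ≤ Φ ≤ 1; complementarity Φ(v,T) + Φ(−v, T − v) = 1; the weight of bond (i,j) is Φ(x_j − x_i,
{x_k − x_i : dist(x_k,x_i) ≤ R ∨ dist(x_k,x_j) ≤ R})) such that for every N, every injective x : Fin
N → ℝ³ and every site i: Σ_{j≠i} w_ij V_LJ(|x_i − x_j|) ≥ e_∞ := ⨅_M E(M+1)/(M+1). Far bonds are NOT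
frozen at ½ (a frozen far field is refuted by "hcp ball + distant interstitial", see CHEAPEST
FALSIFIER); locality = dependence on the two endpoint patterns only. [difficulty: open-problem] -/
@[route_item "route-AtomisticToContinuum-CrystalSplittingCertificates"]
def FiniteRangeSplitting : Prop :=
  ∃ (R : ℝ) (Φ : EuclideanSpace ℝ (Fin 3) → Finset (EuclideanSpace ℝ (Fin 3)) → ℝ), 0 < R ∧ ((∀ v T, 0 ≤ Φ v T ∧ Φ v T ≤ 1) ∧ (∀ v T, v ≠ 0 → Φ v T + Φ (-v) (T.image fun u => u - v) = 1)) ∧ ∀ (N : ℕ) (x : Fin N → EuclideanSpace ℝ (Fin 3)), Function.Injective x → ∀ i : Fin N, (⨅ M : ℕ, Literature.MathematicalPhysics.StatisticalMechanics.groundStateEnergy Literature.MathematicalPhysics.StatisticalMechanics.lennardJones 3 (M + 1) / ((M + 1 : ℕ) : ℝ)) ≤ ∑ j ∈ Finset.univ.erase i, Φ (x j - x i) ((Finset.univ.filter fun k => dist (x k) (x i) ≤ R ∨ dist (x k) (x j) ≤ R).image fun k => x k - x i) * Literature.MathematicalPhysics.StatisticalMechanics.lennardJones (dist (x i) (x 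j))

/-- item stmt-AtomisticToContinuum-4011 · crux · rank 3 · closed · moot by None · by planner
why it might fail: Needs relaxed hcp to be the UNIQUE LJ energy-density minimiser with a gap vs every other environment (fcc-type sites cost only ~7e-5): a tying polytype/FK phase, or failure of sitewise quadratic (phonon) stability c(eta)~eta^2 under bounded-range weights, kills it.
sources: Stillinger2001, KiharaKoba1952, SchwerdtfegerBurrowsSmits2021, PartayOrtnerCsanyi2017, arXiv:1705.01751, FrieseckeTheil2002
[crux] (card R2/F4 made quantitative; X₁) there are R, Φ as in FiniteRangeSplitting, a scale a > 0
and a twelve-point shell S with ShellCloseTo (a/100) S (a·hcpKissingPattern) such that Φ is feasible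
AND for every η > 0 there is c > 0 with: for every finite injective configuration and site k,
weighted site energy < e_∞ + c ⇒ ShellCloseTo η (first shell of k within 5a/4, recentred) S. The
certificate selects the polytype: fcc-type (cuboctahedral) sites must carry slack ≥ c(η) ≈ e_fcc −
e_hcp, surface/vacancy/grain-boundary sites much more; near the optimal crystal c(η) ~ κη² is
sitewise phonon stability. [deps: FiniteRangeSplitting] [difficulty: open-problem] -/
@[route_item "route-AtomisticToContinuum-CrystalSplittingCertificates"]
def StrictSplittingRule : Prop :=
  ∃ (R : ℝ) (Φ : EuclideanSpace ℝ (Fin 3) → Finset (EuclideanSpace ℝ (Fin 3)) → ℝ) (a : ℝ) (S : Finset (EuclideanSpace ℝ (Fin 3))), 0 < R ∧ 0 < a ∧ ((∀ v T, 0 ≤ Φ v T ∧ Φ v T ≤ 1) ∧ (∀ v T, v ≠ 0 → Φ v T + Φ (-v) (T.image fun u => u - v) = 1)) ∧ (∀ (N : ℕ) (x : Fin N → EuclideanSpace ℝ (Fin 3)), Function.Injective x → ∀ i : Fin N, (⨅ M : ℕ, Literature.MathematicalPhysics.StatisticalMechanics.groundStateEnergy Literature.MathematicalPhysics.StatisticalMechanics.lennardJones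 3 (M + 1) / ((M + 1 : ℕ) : ℝ)) ≤ ∑ j ∈ Finset.univ.erase i, Φ (x j - x i) ((Finset.univ.filter fun k => dist (x k) (x i) ≤ R ∨ dist (x k) (x j) ≤ R).image fun k => x k - x i) * Literature.MathematicalPhysics.StatisticalMechanics.lennardJones (dist (x i) (x j))) ∧ Literature.Geometry.DiscreteGeometry.ShellCloseTo (a / 100) S (Literature.Geometry.DiscreteGeometry.hcpKissingPattern.image fun u => a • u) ∧ ∀ η : ℝ, 0 < η → ∃ c : ℝ, 0 < c ∧ ∀ (N : ℕ) (x : Fin N → EuclideanSpace ℝ (Fin 3)), Function.Injective x → ∀ k : Fin N, ∑ j ∈ Finset.univ.erase k, Φ (x j - x k) ((Finset.univ.filter fun l => dist (x l) (x k) ≤ R ∨ dist (x l) (x j) ≤ R).image fun l => x l - x k) * Literature.MathematicalPhysics.StatisticalMechanics.lennardJones (dist (x k) (x j)) < (⨅ M : ℕ, Literature.MathematicalPhysics.StatisticalMechanics.groundStateEnergy Literature.MathematicalPhysics.StatisticalMechanics.lennardJones 3 (M + 1) / ((M + 1 : ℕ) : ℝ)) + c → Literature.Geometry.DiscreteGeometry.ShellCloseTo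 η ((Finset.univ.filter fun j => j ≠ k ∧ dist (x j) (x k) ≤ 5 * a / 4).image fun j => x j - x k) S

/-- item stmt-AtomisticToContinuum-4012 · crux · rank 4 · closed · moot by None · by planner
why it might fail: Exact case = Hales layer argument (h-only; HalesDSP_layerPackings_holds); the robust finite-L version can fail if a near-anticuboctahedral S admits locally-S textures (slow twist, two realisations, KKLS-type flexibility) not eps'-close to one P over radius R'.
sources: HalesDSP2012, Hales2012, arXiv:1209.6043, Literature.Geometry.DiscreteGeometry.HalesDSP_layerPackings_holds, KusnerKusnerLagariasShlosman2018, arXiv:1611.10297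
[crux] (X₂, rule-free) for every a > 0 and every twelve-point S within a/100 of a·hcpKissingPattern
there is a periodic configuration P such that for all δ, R', ε' > 0 there are η > 0 and L with: in
any finite δ-separated configuration, a site i all of whose neighbours within L have first shells
(radius 5a/4) η-close to S has its R'-window two-sidedly ε'-matched to x_i + A(P.points − q) for
some q ∈ P.points and linear isometry A. Exact (η = 0, L = ∞) case = ExactHcpShellsRigidity
(support) via HalesDSP_layerPackings_holds; the crux is the compactness/propagation upgrade with P =
the (possibly non-ideal c/a) hcp crystal of S. [difficulty: L] -/
@[route_item "route-AtomisticToContinuum-CrystalSplittingCertificates"]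
def ShellRigidityHcp : Prop :=
  ∀ a : ℝ, 0 < a → ∀ S : Finset (EuclideanSpace ℝ (Fin 3)), Literature.Geometry.DiscreteGeometry.ShellCloseTo (a / 100) S (Literature.Geometry.DiscreteGeometry.hcpKissingPattern.image fun u => a • u) → ∃ P : Literature.MathematicalPhysics.StatisticalMechanics.PeriodicConfiguration 3, ∀ δ R' ε' : ℝ, 0 < δ → 0 < R' → 0 < ε' → ∃ η : ℝ, 0 < η ∧ ∃ L : ℝ, ∀ (N : ℕ) (x : Fin N → EuclideanSpace ℝ (Fin 3)), (∀ i j, i ≠ j → δ ≤ dist (x i) (x j)) → ∀ i : Fin N, (∀ k : Fin N, dist (x k) (x i) ≤ L → Literature.Geometry.DiscreteGeometry.ShellCloseTo η ((Finset.univ.filter fun j => j ≠ k ∧ dist (x j) (x k) ≤ 5 * a / 4).image fun j => x j - x k) S) → ∃ q ∈ P.points, ∃ A : EuclideanSpace ℝ (Fin 3) →ₗᵢ[ℝ] EuclideanSpace ℝ (Fin 3), (∀ p ∈ P.points, dist p q ≤ R' → ∃ j : Fin N, dist (x j) (x i + A (p - q)) ≤ ε') ∧ (∀ j : Fin N, dist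 (x j) (x i) ≤ R' → ∃ p ∈ P.points, dist (x j) (x i + A (p - q)) ≤ ε')

/-- item stmt-AtomisticToContinuum-4013 · crux · rank 5 · closed · moot by None · by planner
why it might fail: False iff some eps0>0 is lost by EVERY finite-range rule on some site of some configuration: an N-uniform duality gap (quantitative ultimate frustration, Miekisz-type); witness = configuration family whose deficit regions outrun any fixed radius.
sources: Miekisz1998, Miekisz1993, KullEtAl2024, Lagarias2002LocalDensity, BlancLewin2015, card:frustration-range-lp-hierarchy
[crux] (lowest rung; card R1 in finite form) for every ε > 0 there are R(ε) and a rule Φ of radius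
R(ε) with weighted site energy ≥ e_∞ − ε at every site of every finite injective configuration.
FiniteRangeSplitting ⇒ this (Ladder); its refutation for one ε kills the whole line and gives every
certificate route (0620/(a), Flyspeck-type) an infinite minimal nonlocality; in Miękisz's lattice
examples exactly this rung holds while the exact one fails. [difficulty: XL] -/
@[route_item "route-AtomisticToContinuum-CrystalSplittingCertificates"]
def ApproxFiniteRangeSplitting : Prop :=
  ∀ ε : ℝ, 0 < ε → ∃ (R : ℝ) (Φ : EuclideanSpace ℝ (Fin 3) → Finset (EuclideanSpace ℝ (Fin 3)) → ℝ), 0 < R ∧ ((∀ v T, 0 ≤ Φ v T ∧ Φ v T ≤ 1) ∧ (∀ v T, v ≠ 0 → Φ v T + Φ (-v) (T.image fun u => u - v) = 1)) ∧ ∀ (N : ℕ) (x : Fin N → EuclideanSpace ℝ (Fin 3)), Function.Injective x → ∀ i : Fin N, (⨅ M : ℕ, Literature.MathematicalPhysics.StatisticalMechanics.groundStateEnergy Literature.MathematicalPhysics.StatisticalMechanics.lennardJones 3 (M + 1) / ((M + 1 : ℕ) : ℝ)) - ε ≤ ∑ j ∈ Finset.univ.erase i, Φ (x j - x i) ((Finset.univ.filter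 fun k => dist (x k) (x i) ≤ R ∨ dist (x k) (x j) ≤ R).image fun k => x k - x i) * Literature.MathematicalPhysics.StatisticalMechanics.lennardJones (dist (x i) (x j))

/-- item stmt-AtomisticToContinuum-4014 · support · rank 9 · closed · moot by None · by planner
sources: Gale1979, Hoffman1992, BlancLewin2015, arXiv:1504.01153
[support] (the card's lemma (2): "certificates are free") for every N and every injective x : Fin N
→ ℝ³ there are weights w_ij ≥ 0, w_ij + w_ji = 1, with Σ_{j≠i} w_ij V_LJ(r_ij) ≥ e_∞ at every site.
Proof: Gale 1957 / Hoffman supply–demand theorem (max-flow/min-cut with capacities |V(r_ij)|,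
demands e_∞ + Σ_{j: V<0}|V_ij|); the cut condition for A ⊆ Fin N is Σ_{inside A} V + Σ_{cross} V⁺ ≥
|A|·e_∞, implied by E(A) ≥ E(|A|) ≥ |A|·e_∞ (BlancLewin2015_8_holds: e_∞ = inf). Mathlib route:
finite LP duality via hyperplane separation of a finitely generated cone. [difficulty: M] -/
@[route_item "route-AtomisticToContinuum-CrystalSplittingCertificates"]
def FreePairSplitting : Prop :=
  ∀ (N : ℕ) (x : Fin N → EuclideanSpace ℝ (Fin 3)), Function.Injective x → ∃ w : Fin N → Fin N → ℝ, (∀ i j, i ≠ j → 0 ≤ w i j ∧ w i j + w j i = 1) ∧ ∀ i, (⨅ M : ℕ, Literature.MathematicalPhysics.StatisticalMechanics.groundStateEnergy Literature.MathematicalPhysics.StatisticalMechanics.lennardJones 3 (M + 1) / ((M + 1 : ℕ) : ℝ)) ≤ ∑ j ∈ Finset.univ.erase i, w i j * Literature.MathematicalPhysics.StatisticalMechanics.lennardJones (dist (x i) (x j))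

/-- item stmt-AtomisticToContinuum-4015 · support · rank 9 · closed · moot by None · by planner
sources: BlancLewin2015, Literature.MathematicalPhysics.StatisticalMechanics.BlancLewin2015_8_holds
[support] for any rule (box + complementarity) that is feasible, and any c > 0, along every sequence
of Lennard-Jones ground states the fraction of sites with weighted energy ≥ e_∞ + c tends to 0.
Proof: complementarity gives Σ_i (weighted site energy) = interactionEnergy = E(N); E(N) − N·e_∞ =
o(N) and each slack ≥ 0 (feasibility) ⇒ Markov. Uses only BlancLewin2015_8_holds (proved).
[difficulty: provable-now] -/
@[route_item "route-AtomisticToContinuum-CrystalSplittingCertificates"]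
def SlackDensity : Prop :=
  ∀ (R : ℝ) (Φ : EuclideanSpace ℝ (Fin 3) → Finset (EuclideanSpace ℝ (Fin 3)) → ℝ), ((∀ v T, 0 ≤ Φ v T ∧ Φ v T ≤ 1) ∧ (∀ v T, v ≠ 0 → Φ v T + Φ (-v) (T.image fun u => u - v) = 1)) → (∀ (N : ℕ) (x : Fin N → EuclideanSpace ℝ (Fin 3)), Function.Injective x → ∀ i : Fin N, (⨅ M : ℕ, Literature.MathematicalPhysics.StatisticalMechanics.groundStateEnergy Literature.MathematicalPhysics.StatisticalMechanics.lennardJones 3 (M + 1) / ((M + 1 : ℕ) : ℝ)) ≤ ∑ j ∈ Finset.univ.erase i, Φ (x j - x i) ((Finset.univ.filter fun k => dist (x k) (x i) ≤ R ∨ dist (x k) (x j) ≤ R).image fun k => x k - x i) * Literature.MathematicalPhysics.StatisticalMechanics.lennardJones (dist (x i) (x j))) → ∀ c : ℝ, 0 < c → ∀ x : (N : ℕ) → (Fin N → EuclideanSpace ℝ (Fin 3)), (∀ N, Literature.MathematicalPhysics.StatisticalMechanics.IsGroundState Literature.MathematicalPhysics.StatisticalMechanics.lennardJones (x N)) → Filter.Tendsto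 (fun N : ℕ => (Nat.card {k : Fin N // (⨅ M : ℕ, Literature.MathematicalPhysics.StatisticalMechanics.groundStateEnergy Literature.MathematicalPhysics.StatisticalMechanics.lennardJones 3 (M + 1) / ((M + 1 : ℕ) : ℝ)) + c ≤ ∑ j ∈ Finset.univ.erase k, Φ (x N j - x N k) ((Finset.univ.filter fun l => dist (x N l) (x N k) ≤ R ∨ dist (x N l) (x N j) ≤ R).image fun l => x N l - x N k) * Literature.MathematicalPhysics.StatisticalMechanics.lennardJones (dist (x N k) (x N j))} : ℝ) / N) Filter.atTop (nhds 0)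

/-- item stmt-AtomisticToContinuum-4016 · support · rank 9 · closed · moot by None · by planner
sources: BlancLewin2015, arXiv:1504.01153, stmt-AtomisticToContinuum-0629, stmt-AtomisticToContinuum-0714
[support] e_∞ ≤ e(Q) for every periodic configuration Q of ℝ³ (trial blocks of Q as N-point
configurations; cross terms with the exterior bounded by the attractive tail, O(N^{2/3});
summability from PeriodicConfigurationSums). Same content as items 0629 + 0714 of
CrystalLocalRigidity in the e_∞ = ⨅_M E(M+1)/(M+1) normal form used here. [difficulty: M] -/
@[route_item "route-AtomisticToContinuum-CrystalSplittingCertificates"]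
def PeriodicUpperBound : Prop :=
  ∀ Q : Literature.MathematicalPhysics.StatisticalMechanics.PeriodicConfiguration 3, (⨅ M : ℕ, Literature.MathematicalPhysics.StatisticalMechanics.groundStateEnergy Literature.MathematicalPhysics.StatisticalMechanics.lennardJones 3 (M + 1) / ((M + 1 : ℕ) : ℝ)) ≤ Q.energyPerParticle Literature.MathematicalPhysics.StatisticalMechanics.lennardJones

/-- item stmt-AtomisticToContinuum-4017 · support · rank 9 · closed · moot by None · by planner
sources: BlancLewin2015, Literature.MathematicalPhysics.StatisticalMechanics.LennardJonesMinimalDistance_holds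
[support] (the glue X₁ → X₂ → hinge) StrictSplittingRule → ShellRigidityHcp → ∃ P periodic,
DefectVanish(P): for all R', ε' > 0, along every ground-state sequence the fraction of sites whose
R'-window is not ε'-matched to a window of P tends to 0. Proof: SlackDensity with c = c(η(R',ε')) ⇒
o(N) sites with non-η-close shells; ground states are δ-separated
(LennardJonesMinimalDistance_holds) so each bad site spoils ≤ C(L/δ)³ centres; apply
ShellRigidityHcp. [difficulty: M] -/
@[route_item "route-AtomisticToContinuum-CrystalSplittingCertificates"]
def DefectVanishOfStrict : Prop :=
  StrictSplittingRule → ShellRigidityHcp → ∃ P : Literature.MathematicalPhysics.StatisticalMechanics.PeriodicConfiguration 3, ∀ R' ε' : ℝ, 0 < R' → 0 < ε' → ∀ x : (N : ℕ) → (Fin N → EuclideanSpace ℝ (Fin 3)), (∀ N, Literature.MathematicalPhysics.StatisticalMechanics.IsGroundState Literature.MathematicalPhysics.StatisticalMechanics.lennardJones (x N)) → Filter.Tendsto (fun N : ℕ => (Nat.card {i : Fin N // ¬ ∃ q ∈ P.points, ∃ A : EuclideanSpace ℝ (Fin 3) →ₗᵢ[ℝ] EuclideanSpace ℝ (Fin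 3), (∀ p ∈ P.points, dist p q ≤ R' → ∃ j : Fin N, dist (x N j) (x N i + A (p - q)) ≤ ε') ∧ (∀ j : Fin N, dist (x N j) (x N i) ≤ R' → ∃ p ∈ P.points, dist (x N j) (x N i + A (p - q)) ≤ ε')} : ℝ) / N) Filter.atTop (nhds 0)

/-- item stmt-AtomisticToContinuum-4018 · support · rank 9 · closed · moot by None · by planner
sources: BlancLewin2015, arXiv:1504.01153, stmt-AtomisticToContinuum-0752, Literature.MathematicalPhysics.StatisticalMechanics.LennardJonesMinimalDistance_holds
[support] for every periodic P, DefectVanish(P) → IsCrystallizing lennardJones 3: choose R'_k ↑ ∞,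
ε'_k ↓ 0, indices N_k and good sites i_k, translate by −x_{i_k}; q_k ∈ P.points reduces modulo the
lattice to finitely many motif points (subsequence), A_k → A in O(3) (compact); minimal distance of
ground states (proved) and discreteness of P make the matching a local bijection for ε' small,
whence Σ_i f(x_i + τ_k) → Σ_{s ∈ A(P − y)} f(s), multiplicity 1; A(P − y) is again a
PeriodicConfiguration (CrystallizationSymmetries: translate, isometryImage). [difficulty: L] -/
@[route_item "route-AtomisticToContinuum-CrystalSplittingCertificates"]
def DefectVanishCrystallizes : Prop :=
  ∀ P : Literature.MathematicalPhysics.StatisticalMechanics.PeriodicConfiguration 3, (∀ R' ε' : ℝ, 0 < R' → 0 < ε' → ∀ x : (N : ℕ) → (Fin N → EuclideanSpace ℝ (Fin 3)), (∀ N, Literature.MathematicalPhysics.StatisticalMechanics.IsGroundState Literature.MathematicalPhysics.StatisticalMechanics.lennardJones (x N)) → Filter.Tendsto (fun N : ℕ => (Nat.card {i : Fin N // ¬ ∃ q ∈ P.points, ∃ A : EuclideanSpace ℝ (Fin 3) →ₗᵢ[ℝ] EuclideanSpace ℝ (Fin 3), (∀ p ∈ P.points, dist p q ≤ R' → ∃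 j : Fin N, dist (x N j) (x N i + A (p - q)) ≤ ε') ∧ (∀ j : Fin N, dist (x N j) (x N i) ≤ R' → ∃ p ∈ P.points, dist (x N j) (x N i + A (p - q)) ≤ ε')} : ℝ) / N) Filter.atTop (nhds 0)) → Literature.MathematicalPhysics.StatisticalMechanics.IsCrystallizing Literature.MathematicalPhysics.StatisticalMechanics.lennardJones 3

/-- item stmt-AtomisticToContinuum-4019 · support · rank 9 · closed · moot by None · by planner
sources: BlancLewin2015, arXiv:1504.01153, Literature.MathematicalPhysics.StatisticalMechanics.LennardJonesGroundStatesExist_holds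
[support] PeriodicUpperBound → for every periodic P, DefectVanish(P) → HasPeriodicGroundStateEnergy
lennardJones 3: good sites have site energies within o(1) of P's (continuity of V_LJ away from 0,
uniform tail O(R'⁻³) from the minimal distance), bad sites are o(N) with bounded site energy, so
E(N)/N → e(P) (ground states exist for all N: LennardJonesGroundStatesExist_holds); with e_∞ = lim
E(N)/N ≤ e(Q) ∀Q this is IsLeast + Tendsto. [difficulty: L] -/
@[route_item "route-AtomisticToContinuum-CrystalSplittingCertificates"]
def DefectVanishEnergy : Prop :=
  (∀ Q : Literature.MathematicalPhysics.StatisticalMechanics.PeriodicConfiguration 3, (⨅ M : ℕ, Literature.MathematicalPhysics.StatisticalMechanics.groundStateEnergy Literature.MathematicalPhysics.StatisticalMechanics.lennardJones 3 (M + 1) / ((M + 1 : ℕ) : ℝ)) ≤ Q.energyPerParticle Literature.MathematicalPhysics.StatisticalMechanics.lennardJones) → ∀ P : Literature.MathematicalPhysics.StatisticalMechanics.PeriodicConfiguration 3, (∀ R' ε' : ℝ, 0 < R' → 0 < ε' → ∀ x : (N : ℕ) → (Fin N → EuclideanSpace ℝ (Fin 3)), (∀ N, Literature.MathematicalPhysics.StatisticalMechanics.IsGroundState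 Literature.MathematicalPhysics.StatisticalMechanics.lennardJones (x N)) → Filter.Tendsto (fun N : ℕ => (Nat.card {i : Fin N // ¬ ∃ q ∈ P.points, ∃ A : EuclideanSpace ℝ (Fin 3) →ₗᵢ[ℝ] EuclideanSpace ℝ (Fin 3), (∀ p ∈ P.points, dist p q ≤ R' → ∃ j : Fin N, dist (x N j) (x N i + A (p - q)) ≤ ε') ∧ (∀ j : Fin N, dist (x N j) (x N i) ≤ R' → ∃ p ∈ P.points, dist (x N j) (x N i + A (p - q)) ≤ ε')} : ℝ) / N) Filter.atTop (nhds 0)) → Literature.MathematicalPhysics.StatisticalMechanics.HasPeriodicGroundStateEnergy Literature.MathematicalPhysics.StatisticalMechanics.lennardJones 3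

/-- item stmt-AtomisticToContinuum-4020 · support · rank 9 · closed · moot by None · by planner
sources: HalesDSP2012, Literature.Geometry.DiscreteGeometry.HalesDSP_layerPackings_holds
[support] (η = 0, L = ∞ case of ShellRigidityHcp) a nonempty V ⊂ ℝ³ in which every point's punctured
5a/4-neighbourhood, recentred, is exactly congruent to a·hcpKissingPattern is an isometric image of
hcpStacking a (a√(2/3)). Proof: all distances ≥ a, rescale by 2/a to a unit-ball packing with
HasFccOrHcpShells (all hcp) ⇒ HalesDSP_layerPackings_holds gives a Barlow stacking;
anticuboctahedral shells everywhere force the alternating Hägg sequence (LayerShellPatterns /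
BarlowCoordination). [difficulty: M] -/
@[route_item "route-AtomisticToContinuum-CrystalSplittingCertificates"]
def ExactHcpShellsRigidity : Prop :=
  ∀ a : ℝ, 0 < a → ∀ V : Set (EuclideanSpace ℝ (Fin 3)), V.Nonempty → (∀ v ∈ V, ∃ T : Finset (EuclideanSpace ℝ (Fin 3)), (↑T : Set (EuclideanSpace ℝ (Fin 3))) = (fun u => u - v) '' {u ∈ V | u ≠ v ∧ dist u v ≤ 5 * a / 4} ∧ Literature.Geometry.DiscreteGeometry.ShellCloseTo 0 T (Literature.Geometry.DiscreteGeometry.hcpKissingPattern.image fun u => a • u)) → ∃ g : EuclideanSpace ℝ (Fin 3) ≃ᵢ EuclideanSpace ℝ (Fin 3), V = g '' Literature.MathematicalPhysics.StatisticalMechanics.hcpStacking a (a * Real.sqrt (2 / 3))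

/-- item stmt-AtomisticToContinuum-4021 · support · rank 9 · closed · moot by None · by planner
sources: Miekisz1998
[support] the rungs are nested: StrictSplittingRule → FiniteRangeSplitting and FiniteRangeSplitting
→ ApproxFiniteRangeSplitting (same R, Φ). Pure logic; records that refuting a lower rung refutes the
higher ones. [difficulty: provable-now] -/
@[route_item "route-AtomisticToContinuum-CrystalSplittingCertificates"]
def Ladder : Prop :=
  (StrictSplittingRule → FiniteRangeSplitting) ∧ (FiniteRangeSplitting → ApproxFiniteRangeSplitting)

/-- item stmt-AtomisticToContinuum-4022 · assembly · rank 1 · closed · moot by None · by planner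
sources: BlancLewin2015, arXiv:1504.01153
[assembly] StrictSplittingRule → ShellRigidityHcp → Crystallization (via DefectVanishOfStrict,
DefectVanishCrystallizes, DefectVanishEnergy, PeriodicUpperBound). -/
@[route_item "route-AtomisticToContinuum-CrystalSplittingCertificates"]
def Assembly : Prop :=
  StrictSplittingRule → ShellRigidityHcp → Literature.MathematicalPhysics.StatisticalMechanics.Crystallization

end Summit.AtomisticToContinuum.Crystallization.Theses.CrystalSplittingCertificates
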